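import Literature.Analysis.Complex.RoucheTheorem
import Summits.RiemannHypothesis.RiemannHypothesis.Theorems.TiltedLandingLaw421R2Ready
import Summits.RiemannHypothesis.RiemannHypothesis.Theorems.TiltedLandingLaw421SuccessorCertificateFrozen

/-! # TiltedLandingLaw421 — W-08 round 3: ISOLATED PAIR ⇒ ONE REAL CRITICAL POINT (Rouché), kernel shape of the «one-step landing / tilt» lemma
(C4 «kernel desk» §K.22, rh-idea-6 g26; answers director (CA325)(4)/(CA327)(b) and C3 ADDENDUM-5 §B «two Rouché circles»; files-only cell: NOT proposed by C4)

Pure complex analysis over the tree's exact-count Rouché theorem (`Literature.Analysis.Complex.Rouche.existsUnique_zero_of_norm_sub_lt`), no `EngineHyps5`: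
if `G = q · h` near the closed disc `‖z − a‖ ≤ r` with `q z = (z − a)² + b²` (the PAIR FACTOR of an upper zero `a + ib`), `h` holomorphic and zero-free
there, and the field of the rest is small on the circle — `‖q z · (h′ z / h z)‖ < 2r` on `‖z − a‖ = r` — then `G′` has EXACTLY ONE zero in the disc
(`existsUnique_crit_of_isolated`), and when `G` is real (`G (conj z) = conj (G z)`) that zero is REAL (`crit_im_eq_zero_of_real`): the isolated pair's
«child» is a real critical point of `G = f^{(j)}` — the TILT candidate of level `j` (its NL sign `0 ≤ G·G″` is the convexity half, §K.22c).
SPLIT FOR LANDING (C4 g27, director (CA337): modules ≤ 400 l): this is MODULE 1 of 2 = §K.22/§K.22c/§K.23/§K.22f (rev f `isoTiltK22-revf-W08-C4-rh-idea-6-g26.lean` 0efff3078a3d552c lines 1–361, byte-identical); §K.25 pair factorisation, §K.26 diameter realness, §K.27 G-only form are MODULE 2 (`…IsoTiltPair`), which imports this one.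
Nothing here bears on the truth of RH; RH is NOT proved. -/

namespace RhW08.IsolatedTilt

open Complex Metric Set
open scoped ComplexConjugate

/-- §K.22 the PAIR FACTOR of an upper zero `a + ib`: `q z = (z − a)² + b²` (zeros `a ± ib`). -/
def pairQ (a b : ℝ) (z : ℂ) : ℂ := (z - a) ^ 2 + (b : ℂ) ^ 2

-- v2 (dedup): `q′ z = 2(z − a)` is the LANDED `RhW07.Law421.SuccessorCertificate.hasDerivAt_quadP` (…SuccessorCertificateFrozen.lean l.31), CITED at each use —
-- the v1 image re-declared it as `hasDerivAt_pairQ` and was SKIPPED by the gate lint `dedup.landed` (lead g14, 06:22Z); v3: the v2 helper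
-- `eq_ofReal_re_of_im` (≡ landed `Literature.Analysis.FluidPDE.Tao2016.eq_ofReal_re_of_im_eq_zero`, lead g18 dry-run 07:28Z) is INLINED as `Complex.ext` terms, no decl.

/-- ★★★ §K.22a **ISOLATED PAIR ⇒ EXACTLY ONE CRITICAL POINT IN THE DISC** (Rouché against `q′ = 2(z − a)`): `G = q·h` on the ball `‖z − a‖ < ρ`, `h` holomorphic
and zero-free there, `‖q·(h′/h)‖ < 2r` on the circle `‖z − a‖ = r` (`0 < r < ρ`) ⇒ `G′` has exactly one zero `u` in the closed disc, and `‖u − a‖ < r`. -/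
theorem existsUnique_crit_of_isolated {G h : ℂ → ℂ} {a b r ρ : ℝ} (hr : 0 < r) (hrρ : r < ρ)
    (hh : DifferentiableOn ℂ h (ball (a : ℂ) ρ)) (hh0 : ∀ z ∈ ball (a : ℂ) ρ, h z ≠ 0)
    (hG : ∀ z ∈ ball (a : ℂ) ρ, G z = pairQ a b z * h z)
    (hsmall : ∀ z : ℂ, ‖z - a‖ = r → ‖pairQ a b z * (deriv h z / h z)‖ < 2 * r) :
    ∃ u : ℂ, ‖u - (a : ℂ)‖ < r ∧ deriv G u = 0 ∧ ∀ v ∈ closedBall (a : ℂ) r, deriv G v = 0 → v = u := by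
  set f₁ : ℂ → ℂ := fun z => 2 * (z - a) + pairQ a b z * (deriv h z / h z) with hf₁
  set g₁ : ℂ → ℂ := fun z => 2 * (z - a) with hg₁
  have hGd : ∀ z ∈ ball (a : ℂ) ρ, deriv G z = h z * f₁ z := by
    intro z hz
    have hhz : HasDerivAt h (deriv h z) z := (hh.differentiableAt (isOpen_ball.mem_nhds hz)).hasDerivAt
    have hprod : HasDerivAt (fun w => pairQ a b w * h w) (2 * (z - a) * h z + pairQ a b z * deriv h z) z :=
      (RhW07.Law421.SuccessorCertificate.hasDerivAt_quadP a b z : HasDerivAt (pairQ a b) (2 * (z - a)) z).mul hhz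
    have hEq : G =ᶠ[nhds z] fun w => pairQ a b w * h w :=
      Filter.eventually_of_mem (isOpen_ball.mem_nhds hz) fun w hw => hG w hw
    rw [hEq.deriv_eq, hprod.deriv]
    have hz0 := hh0 z hz
    simp only [hf₁]
    field_simp
  have hf₁d : DifferentiableOn ℂ f₁ (ball (a : ℂ) ρ) := by
    have hd : DifferentiableOn ℂ (deriv h) (ball (a : ℂ) ρ) := hh.deriv isOpen_ball
    have hq : DifferentiableOn ℂ (pairQ a b) (ball (a : ℂ) ρ) := fun z _ =>
      (RhW07.Law421.SuccessorCertificate.hasDerivAt_quadP a b z : HasDerivAt (pairQ a b) (2 * (z - a)) z).differentiableAt.differentiableWithinAt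
    exact ((differentiableOn_const _).mul (differentiableOn_id.sub (differentiableOn_const _))).add (hq.mul (hd.div hh hh0))
  have hg₁d : DifferentiableOn ℂ g₁ (ball (a : ℂ) ρ) :=
    (differentiableOn_const _).mul (differentiableOn_id.sub (differentiableOn_const _))
  have hnorm : ∀ z : ℂ, ‖z - a‖ = r → ‖g₁ z‖ = 2 * r := by
    intro z hz
    simp only [hg₁, norm_mul, hz]
    norm_num
  have hR : ∀ z : ℂ, ‖z - a‖ = r → ‖f₁ z - g₁ z‖ < ‖g₁ z‖ := by
    intro z hz
    rw [hnorm z hz]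
    have : f₁ z - g₁ z = pairQ a b z * (deriv h z / h z) := by simp only [hf₁, hg₁]; ring
    rw [this]
    exact hsmall z hz
  have hu₀ : (a : ℂ) ∈ closedBall (a : ℂ) r := mem_closedBall_self hr.le
  have hg0 : g₁ a = 0 := by simp [hg₁]
  have hg1 : deriv g₁ a ≠ 0 := by
    have h2 : HasDerivAt g₁ (2 * 1) (a : ℂ) := ((hasDerivAt_id (a : ℂ)).sub_const (a : ℂ)).const_mul 2
    rw [h2.deriv]
    norm_num
  have huniq : ∀ v ∈ closedBall (a : ℂ) r, g₁ v = 0 → v = a := by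
    intro v _ hv
    have : 2 * (v - a) = 0 := hv
    have h2 : (v - a) = 0 := by
      rcases mul_eq_zero.mp this with h | h
      · norm_num at h
      · exact h
    exact sub_eq_zero.mp h2
  obtain ⟨u, hu, hfu, -, huq⟩ :=
    Literature.Analysis.Complex.Rouche.existsUnique_zero_of_norm_sub_lt hr hrρ hf₁d hg₁d hR hu₀ hg0 hg1 huniq
  have hball : ∀ v ∈ closedBall (a : ℂ) r, v ∈ ball (a : ℂ) ρ := fun v hv => closedBall_subset_ball hrρ hv
  have humem : u ∈ closedBall (a : ℂ) r := by
    rw [mem_closedBall, dist_eq_norm]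
    exact hu.le
  refine ⟨u, hu, ?_, ?_⟩
  · rw [hGd u (hball u humem), hfu, mul_zero]
  · intro v hv hGv
    have hv' := hball v hv
    rw [hGd v hv'] at hGv
    exact huq v hv ((mul_eq_zero.mp hGv).resolve_left (hh0 v hv'))

/-- ★★★ §K.22b **… AND IT IS REAL** when `G` is real (`G ∘ conj = conj ∘ G`): the conjugate of a critical point is a critical point in the same disc (centre real),
so uniqueness forces `u = conj u`. The isolated pair's «child» at the next level is a REAL critical point of `G` — the pair LANDS in one step. -/
theorem crit_im_eq_zero_of_real {G : ℂ → ℂ} {a r : ℝ} {u : ℂ} (hGreal : ∀ z : ℂ, G (conj z) = conj (G z))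
    (hGdiff : DifferentiableAt ℂ G u) (hu : ‖u - (a : ℂ)‖ < r) (hGu : deriv G u = 0)
    (huniq : ∀ v ∈ closedBall (a : ℂ) r, deriv G v = 0 → v = u) : u.im = 0 := by
  have hfun : (conj ∘ G ∘ conj : ℂ → ℂ) = G := by
    funext z
    simp only [Function.comp_apply, hGreal, Complex.conj_conj]
  have hd : HasDerivAt G (conj (deriv G u)) (conj u) := by
    have := hGdiff.hasDerivAt.conj_conj
    rwa [hfun] at this
  have hd0 : deriv G (conj u) = 0 := by rw [hd.deriv, hGu, map_zero]
  have hmem : conj u ∈ closedBall (a : ℂ) r := by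
    rw [mem_closedBall, dist_eq_norm]
    have : conj u - (a : ℂ) = conj (u - a) := by simp [map_sub, Complex.conj_ofReal]
    rw [this, Complex.norm_conj]
    exact hu.le
  have h := huniq _ hmem hd0
  exact Complex.conj_eq_iff_im.mp h

/-- ★★ §K.22c (real-algebra core of the CONVEXITY half) **the isolated pair's real critical point is an NL event**: with `Q = q(x) > 0`, `H = h(x) ≠ 0`,
`H₁ = h′(x)`, `H₂ = h″(x)` (all real at a real point of a real `h`), the critical-point relation `2(x − a)·H + Q·H₁ = 0` and the smallness
`Q·(|H₂|·|H| + 2·H₁²) ≤ 2·H²` (i.e. `q·(|h″/h| + 2|h′/h|²) ≤ 2`), the NL product `G·G″ = (Q·H)·(2H + 4(x − a)H₁ + Q·H₂)` is `≥ 0` (and `G = Q·H ≠ 0`). -/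
theorem nl_sign_of_isolated_real {Q H H₁ H₂ c : ℝ} (hQ : 0 < Q) (hH : H ≠ 0)
    (hcrit : 2 * c * H + Q * H₁ = 0) (hsmall : Q * (|H₂| * |H| + 2 * H₁ ^ 2) ≤ 2 * H ^ 2) :
    Q * H ≠ 0 ∧ 0 ≤ (Q * H) * (2 * H + 4 * c * H₁ + Q * H₂) := by
  refine ⟨mul_ne_zero hQ.ne' hH, ?_⟩
  have hcH : 2 * c * H = -(Q * H₁) := by linarith
  have h4 : 4 * c * H₁ * (Q * H) = -(2 * Q ^ 2 * H₁ ^ 2) := by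
    have e : 4 * c * H₁ * (Q * H) = 2 * (2 * c * H) * (Q * H₁) := by ring
    rw [e, hcH]
    ring
  have hexp : (Q * H) * (2 * H + 4 * c * H₁ + Q * H₂) = Q * (2 * H ^ 2 - 2 * Q * H₁ ^ 2 + Q * (H * H₂)) := by
    have e : (Q * H) * (2 * H + 4 * c * H₁ + Q * H₂) = 2 * Q * H ^ 2 + 4 * c * H₁ * (Q * H) + Q ^ 2 * (H * H₂) := by ring
    rw [e, h4]
    ring
  rw [hexp]
  have hHH₂ : -(|H₂| * |H|) ≤ H * H₂ := by
    have := neg_abs_le (H * H₂)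
    rw [abs_mul] at this
    linarith [mul_comm |H| |H₂|]
  have hin : 0 ≤ 2 * H ^ 2 - 2 * Q * H₁ ^ 2 + Q * (H * H₂) := by nlinarith [hQ.le, hHH₂, hsmall]
  exact mul_nonneg hQ.le hin

/-- ★★ §K.22c′ (dictionary to `NLEventOf`) at a REAL point `x` where the values `G x`, `G′ x = 0`, `G″ x` are real: the NL clause of `NLEventOf f j x` for `G = f^{(j)}`
reads `(G′ x).re = 0 ∧ (G x).re ≠ 0 ∧ 0 ≤ (G x).re * (G″ x).re`; this is it, from the real numbers of §K.22c. -/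
theorem nlEvent_clause_of_real_values {G0 G2 : ℂ} {Q H H₁ H₂ c : ℝ} (hQ : 0 < Q) (hH : H ≠ 0)
    (hcrit : 2 * c * H + Q * H₁ = 0) (hsmall : Q * (|H₂| * |H| + 2 * H₁ ^ 2) ≤ 2 * H ^ 2)
    (hG0 : G0 = ((Q * H : ℝ) : ℂ)) (hG2 : G2 = ((2 * H + 4 * c * H₁ + Q * H₂ : ℝ) : ℂ)) :
    G0.re ≠ 0 ∧ 0 ≤ G0.re * G2.re := by
  obtain ⟨h1, h2⟩ := nl_sign_of_isolated_real hQ hH hcrit hsmall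
  subst hG0 hG2
  simp only [Complex.ofReal_re]
  exact ⟨h1, h2⟩


/-- (K) §K.22d first derivative of the pair product on the ball: `G′ z = 2(z − a)·h z + q z·h′ z`. -/
theorem deriv_pair_mul {G h : ℂ → ℂ} {a b ρ : ℝ} (hh : DifferentiableOn ℂ h (ball (a : ℂ) ρ))
    (hG : ∀ z ∈ ball (a : ℂ) ρ, G z = pairQ a b z * h z) {z : ℂ} (hz : z ∈ ball (a : ℂ) ρ) :
    deriv G z = 2 * (z - a) * h z + pairQ a b z * deriv h z := by
  have hhz : HasDerivAt h (deriv h z) z := (hh.differentiableAt (isOpen_ball.mem_nhds hz)).hasDerivAt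
  have hprod : HasDerivAt (fun w => pairQ a b w * h w) (2 * (z - a) * h z + pairQ a b z * deriv h z) z :=
    (RhW07.Law421.SuccessorCertificate.hasDerivAt_quadP a b z : HasDerivAt (pairQ a b) (2 * (z - a)) z).mul hhz
  have hEq : G =ᶠ[nhds z] fun w => pairQ a b w * h w :=
    Filter.eventually_of_mem (isOpen_ball.mem_nhds hz) fun w hw => hG w hw
  rw [hEq.deriv_eq, hprod.deriv]

/-- (K) §K.22d `G` is differentiable at every point of the ball. -/
theorem differentiableAt_of_pair_mul {G h : ℂ → ℂ} {a b ρ : ℝ} (hh : DifferentiableOn ℂ h (ball (a : ℂ) ρ))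
    (hG : ∀ z ∈ ball (a : ℂ) ρ, G z = pairQ a b z * h z) {z : ℂ} (hz : z ∈ ball (a : ℂ) ρ) : DifferentiableAt ℂ G z := by
  have hhz : HasDerivAt h (deriv h z) z := (hh.differentiableAt (isOpen_ball.mem_nhds hz)).hasDerivAt
  have hprod : HasDerivAt (fun w => pairQ a b w * h w) (2 * (z - a) * h z + pairQ a b z * deriv h z) z :=
    (RhW07.Law421.SuccessorCertificate.hasDerivAt_quadP a b z : HasDerivAt (pairQ a b) (2 * (z - a)) z).mul hhz
  have hEq : G =ᶠ[nhds z] fun w => pairQ a b w * h w :=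
    Filter.eventually_of_mem (isOpen_ball.mem_nhds hz) fun w hw => hG w hw
  exact (hEq.differentiableAt_iff).mpr hprod.differentiableAt

/-- ★ (K) §K.22d SECOND derivative of the pair product on the ball: `G″ z = 2·h z + 4(z − a)·h′ z + q z·h″ z`. -/
theorem deriv2_pair_mul {G h : ℂ → ℂ} {a b ρ : ℝ} (hh : DifferentiableOn ℂ h (ball (a : ℂ) ρ))
    (hG : ∀ z ∈ ball (a : ℂ) ρ, G z = pairQ a b z * h z) {z : ℂ} (hz : z ∈ ball (a : ℂ) ρ) :
    deriv (deriv G) z = 2 * h z + 4 * (z - a) * deriv h z + pairQ a b z * deriv (deriv h) z := by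
  have hEq : deriv G =ᶠ[nhds z] fun w => 2 * (w - a) * h w + pairQ a b w * deriv h w :=
    Filter.eventually_of_mem (isOpen_ball.mem_nhds hz) fun w hw => deriv_pair_mul hh hG hw
  rw [hEq.deriv_eq]
  have hhz : HasDerivAt h (deriv h z) z := (hh.differentiableAt (isOpen_ball.mem_nhds hz)).hasDerivAt
  have hh2 : HasDerivAt (deriv h) (deriv (deriv h) z) z :=
    ((hh.deriv isOpen_ball).differentiableAt (isOpen_ball.mem_nhds hz)).hasDerivAt
  have hlin : HasDerivAt (fun w : ℂ => 2 * (w - a)) (2 * 1) z := ((hasDerivAt_id z).sub_const (a : ℂ)).const_mul 2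
  have hsum : HasDerivAt (fun w => 2 * (w - a) * h w + pairQ a b w * deriv h w)
      (2 * 1 * h z + 2 * (z - a) * deriv h z + (2 * (z - a) * deriv h z + pairQ a b z * deriv (deriv h) z)) z :=
    (hlin.mul hhz).add ((RhW07.Law421.SuccessorCertificate.hasDerivAt_quadP a b z : HasDerivAt (pairQ a b) (2 * (z - a)) z).mul hh2)
  rw [hsum.deriv]
  ring

/-- (K) the pair factor at a real point is the real number `(x − a)² + b²`. -/
theorem pairQ_ofReal (a b x : ℝ) : pairQ a b (x : ℂ) = (((x - a) ^ 2 + b ^ 2 : ℝ) : ℂ) := by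
  simp only [pairQ]
  push_cast
  ring

/-- ★★★ §K.22e **ISOLATED PAIR ⇒ TILT** (the NL clause of `NLEventOf`, assembled): under §K.22a's Rouché smallness on the circle, reality of `G` and of the values of
`h, h′, h″` on the real diameter, and the convexity smallness `q(x)·(|h″ x|·|h x| + 2·(h′ x)²) ≤ 2·(h x)²` there, `G = q·h` has a REAL point `x`, `|x − a| < r`,
with `G′ x = 0`, `G x ≠ 0` and `0 ≤ Re G x · Re G″ x` — for `G = f^{(j)}` and `|x − x₀| < (j+3)R/2` this is `TiltReady` at level `j`. -/
theorem tilt_of_isolated {G h : ℂ → ℂ} {a b r ρ : ℝ} (hr : 0 < r) (hrρ : r < ρ) (hb : 0 < b)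
    (hh : DifferentiableOn ℂ h (ball (a : ℂ) ρ)) (hh0 : ∀ z ∈ ball (a : ℂ) ρ, h z ≠ 0)
    (hG : ∀ z ∈ ball (a : ℂ) ρ, G z = pairQ a b z * h z)
    (hsmall : ∀ z : ℂ, ‖z - a‖ = r → ‖pairQ a b z * (deriv h z / h z)‖ < 2 * r)
    (hGreal : ∀ z : ℂ, G (conj z) = conj (G z))
    (hreal : ∀ x : ℝ, |x - a| < r → (h x).im = 0 ∧ (deriv h x).im = 0 ∧ (deriv (deriv h) x).im = 0)
    (hsmall2 : ∀ x : ℝ, |x - a| < r →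
      ((x - a) ^ 2 + b ^ 2) * (|(deriv (deriv h) x).re| * |(h x).re| + 2 * (deriv h x).re ^ 2) ≤ 2 * (h x).re ^ 2) :
    ∃ x : ℝ, |x - a| < r ∧ deriv G x = 0 ∧ (G x).re ≠ 0 ∧ 0 ≤ (G x).re * (deriv (deriv G) x).re := by
  obtain ⟨u, hu, hGu, huniq⟩ := existsUnique_crit_of_isolated hr hrρ hh hh0 hG hsmall
  have hball : ∀ v : ℂ, ‖v - (a : ℂ)‖ < r → v ∈ ball (a : ℂ) ρ := fun v hv => by
    rw [mem_ball, dist_eq_norm]; exact hv.trans hrρ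
  have huball := hball u hu
  have him : u.im = 0 := crit_im_eq_zero_of_real hGreal (differentiableAt_of_pair_mul hh hG huball) hu hGu huniq
  set x : ℝ := u.re with hx
  have hux : u = (x : ℂ) := Complex.ext (by simp [hx]) (by simp [him])
  have hxa : |x - a| < r := by
    have : ‖(x : ℂ) - (a : ℂ)‖ < r := by rw [← hux]; exact hu
    rw [← Complex.ofReal_sub, Complex.norm_real, Real.norm_eq_abs] at this
    exact this
  have hxball : (x : ℂ) ∈ ball (a : ℂ) ρ := by rw [← hux]; exact huball
  obtain ⟨hh_im, hh1_im, hh2_im⟩ := hreal x hxa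
  set Q : ℝ := (x - a) ^ 2 + b ^ 2 with hQ
  set H : ℝ := (h x).re with hH
  set H₁ : ℝ := (deriv h x).re with hH₁
  set H₂ : ℝ := (deriv (deriv h) x).re with hH₂
  have hQpos : 0 < Q := by rw [hQ]; positivity
  have hHne : H ≠ 0 := by
    intro h0
    apply hh0 _ hxball
    rw [show h x = ((h x).re : ℂ) from Complex.ext (by simp) (by simp [hh_im]), ← hH, h0, Complex.ofReal_zero]
  have hhx : h x = (H : ℂ) := by rw [hH]; exact Complex.ext (by simp) (by simp [hh_im])
  have hh1x : deriv h x = (H₁ : ℂ) := by rw [hH₁]; exact Complex.ext (by simp) (by simp [hh1_im])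
  have hh2x : deriv (deriv h) x = (H₂ : ℂ) := by rw [hH₂]; exact Complex.ext (by simp) (by simp [hh2_im])
  have hqx : pairQ a b (x : ℂ) = (Q : ℂ) := by rw [hQ]; exact pairQ_ofReal a b x
  -- the critical-point relation in real numbers
  have hcritC : 2 * ((x : ℂ) - a) * h x + pairQ a b x * deriv h x = 0 := by
    rw [← deriv_pair_mul hh hG hxball, ← hux]; exact hGu
  have hcrit : 2 * (x - a) * H + Q * H₁ = 0 := by
    rw [hhx, hh1x, hqx] at hcritC
    have := congrArg Complex.re hcritC
    simpa using this
  have hsm : Q * (|H₂| * |H| + 2 * H₁ ^ 2) ≤ 2 * H ^ 2 := hsmall2 x hxa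
  have hG0 : G x = ((Q * H : ℝ) : ℂ) := by
    rw [hG _ hxball, hqx, hhx]; push_cast; ring
  have hG2 : deriv (deriv G) x = ((2 * H + 4 * (x - a) * H₁ + Q * H₂ : ℝ) : ℂ) := by
    rw [deriv2_pair_mul hh hG hxball, hhx, hh1x, hh2x, hqx]; push_cast; ring
  obtain ⟨h1, h2⟩ := nlEvent_clause_of_real_values (c := x - a) hQpos hHne hcrit hsm hG0 hG2
  refine ⟨x, hxa, ?_, h1, h2⟩
  rw [← hux]; exact hGu

/-- (sanity · non-vacuity) the BARE PAIR `G = q` (`h ≡ 1`): every hypothesis of `tilt_of_isolated` is met, so the lemma fires (the real critical point is `a`,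
`G a = b² > 0`, `G″ a = 2 > 0`: the textbook one-step landing of an isolated pair). -/
example (a b r ρ : ℝ) (hr : 0 < r) (hrρ : r < ρ) (hb : 0 < b) :
    ∃ x : ℝ, |x - a| < r ∧ deriv (pairQ a b) x = 0 ∧ (pairQ a b x).re ≠ 0 ∧
      0 ≤ (pairQ a b x).re * (deriv (deriv (pairQ a b)) x).re :=
  tilt_of_isolated (G := pairQ a b) (h := fun _ => 1) hr hrρ hb (differentiableOn_const _) (by simp) (by simp)
    (by intro z _; simp; linarith)
    (by intro z; simp [pairQ, Complex.conj_ofReal])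
    (by intro x _; simp)
    (by intro x _; simp)

/-! ## §K.23 FRAME DICTIONARY — the NL shape at a real point of the LAW's range IS `TiltReady` (hence `ReadyR2`) -/

open RhIdea6.G17.W07C7 RhIdea6.G17.W07C7.Rev6 RhIdea6.G18.W07C8.Law421BirthS RhIdea6.G19.W07C11.Seam RhIdea6.G20.W07C12.Frac in
/-- ★★ §K.23a for `G = f^{(j)}`: `G′ x = 0 ∧ Re G x ≠ 0 ∧ 0 ≤ Re G x · Re G″ x` at a real `x` with `|x − x₀| < (j+3)R/2` is `TiltReady` at level `j`
(state-free: any `u`). [`iteratedDeriv_succ`; `NLEventOf f j x` literally.] -/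
theorem tiltReady_of_nlShape {f : ℂ → ℂ} {j : ℕ} {x x₀ : ℝ} (η s hmax R Hs : ℝ) (B : ℕ) (u : ℂ)
    (hx : |x - x₀| < ((j : ℝ) + 3) * R / 2)
    (h1 : deriv (iteratedDeriv j f) x = 0) (h2 : (iteratedDeriv j f x).re ≠ 0)
    (h3 : 0 ≤ (iteratedDeriv j f x).re * (deriv (deriv (iteratedDeriv j f)) x).re) :
    RhW08.StSwap.TiltReady η f x₀ s hmax R Hs B j u := by
  refine ⟨x, hx, ?_, h2, ?_⟩
  · rw [iteratedDeriv_succ, h1]; simp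
  · have e : iteratedDeriv (j + 2) f = deriv (deriv (iteratedDeriv j f)) := by
      rw [show j + 2 = (j + 1) + 1 from rfl, iteratedDeriv_succ, iteratedDeriv_succ]
    rw [e]; exact h3

open RhIdea6.G17.W07C7 RhIdea6.G17.W07C7.Rev6 RhIdea6.G18.W07C8.Law421BirthS RhIdea6.G19.W07C11.Seam RhIdea6.G20.W07C12.Frac in
/-- (K) §K.23b `TiltReady ⇒ ReadyR2` (Ready′ = CumReady (WindowReady ∨ TiltReady)). -/
theorem readyR2_of_tiltReady {η : ℝ} {f : ℂ → ℂ} {x₀ s hmax R Hs : ℝ} {B j : ℕ} {u : ℂ}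
    (h : RhW08.StSwap.TiltReady η f x₀ s hmax R Hs B j u) : RhW08.StSwap.ReadyR2 η f x₀ s hmax R Hs B j u :=
  cumReady_of_ready (Ready := RhW08.StSwap.WinOrTilt) (Or.inr h)

/-- ★★★ §K.23c **ISOLATED PAIR AT LEVEL j ⇒ Ready′ AT LEVEL j** (assembled with §K.22e): if `f^{(j)} = q·h` on a ball `‖z − a‖ < ρ` around the real foot `a`
of an upper zero `a + ib` with the §K.22 hypotheses (circle smallness, reality, convexity smallness) and the disc sits in the LAW's range,
`|a − x₀| + r ≤ (j+3)R/2`, then `TiltReady` — hence `ReadyR2` — holds at level `j` (for every state `u`: the stop is state-free). -/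
theorem readyR2_of_isolated {f h : ℂ → ℂ} {j : ℕ} {a b r ρ x₀ : ℝ} (η s hmax R Hs : ℝ) (B : ℕ) (u : ℂ)
    (hr : 0 < r) (hrρ : r < ρ) (hb : 0 < b)
    (hh : DifferentiableOn ℂ h (ball (a : ℂ) ρ)) (hh0 : ∀ z ∈ ball (a : ℂ) ρ, h z ≠ 0)
    (hG : ∀ z ∈ ball (a : ℂ) ρ, iteratedDeriv j f z = pairQ a b z * h z)
    (hsmall : ∀ z : ℂ, ‖z - a‖ = r → ‖pairQ a b z * (deriv h z / h z)‖ < 2 * r)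
    (hGreal : ∀ z : ℂ, iteratedDeriv j f (conj z) = conj (iteratedDeriv j f z))
    (hreal : ∀ x : ℝ, |x - a| < r → (h x).im = 0 ∧ (deriv h x).im = 0 ∧ (deriv (deriv h) x).im = 0)
    (hsmall2 : ∀ x : ℝ, |x - a| < r →
      ((x - a) ^ 2 + b ^ 2) * (|(deriv (deriv h) x).re| * |(h x).re| + 2 * (deriv h x).re ^ 2) ≤ 2 * (h x).re ^ 2)
    (hwin : |a - x₀| + r ≤ ((j : ℝ) + 3) * R / 2) :
    RhW08.StSwap.TiltReady η f x₀ s hmax R Hs B j u ∧ RhW08.StSwap.ReadyR2 η f x₀ s hmax R Hs B j u := by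
  obtain ⟨x, hxa, h1, h2, h3⟩ := tilt_of_isolated hr hrρ hb hh hh0 hG hsmall hGreal hreal hsmall2
  have hx : |x - x₀| < ((j : ℝ) + 3) * R / 2 := by
    have := abs_sub_le x a x₀
    linarith
  have hT := tiltReady_of_nlShape η s hmax R Hs B u hx h1 h2 h3
  exact ⟨hT, readyR2_of_tiltReady hT⟩

/-! ## §K.22f FIELD-SHAPED SMALLNESS — both smallness clauses of §K.22 from bounds on the logarithmic derivative of the rest `h` («isolation» as the hands will supply it) -/

/-- (K) on the circle `‖z − a‖ = r`: `‖q z‖ ≤ r² + b²`. -/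
theorem norm_pairQ_le_of_circle {a b r : ℝ} {z : ℂ} (hz : ‖z - (a : ℂ)‖ = r) : ‖pairQ a b z‖ ≤ r ^ 2 + b ^ 2 := by
  unfold pairQ
  calc ‖(z - a) ^ 2 + (b : ℂ) ^ 2‖ ≤ ‖(z - a) ^ 2‖ + ‖(b : ℂ) ^ 2‖ := norm_add_le _ _
    _ = r ^ 2 + b ^ 2 := by rw [norm_pow, norm_pow, hz, Complex.norm_real, Real.norm_eq_abs, sq_abs]

/-- ★★ §K.22f CIRCLE smallness from a FIELD bound: `‖h′/h‖ ≤ L` on the circle and `(r² + b²)·L < 2r` ⇒ `hsmall` of §K.22a.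
(E.g. `r = 2b`: `L < 4/(5b)` — the field of the other zeros + remainder at the pair must be small against `1/height`.) -/
theorem hsmall_of_field_bound {h : ℂ → ℂ} {a b r L : ℝ} (hL : ∀ z : ℂ, ‖z - a‖ = r → ‖deriv h z / h z‖ ≤ L)
    (hrL : (r ^ 2 + b ^ 2) * L < 2 * r) :
    ∀ z : ℂ, ‖z - a‖ = r → ‖pairQ a b z * (deriv h z / h z)‖ < 2 * r := by
  intro z hz
  rw [norm_mul]
  have hLz := hL z hz
  have h0 : 0 ≤ L := (norm_nonneg _).trans hLz
  calc ‖pairQ a b z‖ * ‖deriv h z / h z‖ ≤ (r ^ 2 + b ^ 2) * L :=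
        mul_le_mul (norm_pairQ_le_of_circle hz) hLz (norm_nonneg _) (by positivity)
    _ < 2 * r := hrL

/-- ★★ §K.22f DIAMETER (convexity) smallness from FIELD bounds: `|Re h′ x| ≤ L₁·|Re h x|`, `|Re h″ x| ≤ L₂·|Re h x|` on `|x − a| < r` and
`(r² + b²)·(L₂ + 2·L₁²) ≤ 2` ⇒ `hsmall2` of §K.22e. -/
theorem hsmall2_of_field_bound {h : ℂ → ℂ} {a b r L₁ L₂ : ℝ}
    (h1 : ∀ x : ℝ, |x - a| < r → |(deriv h x).re| ≤ L₁ * |(h x).re|)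
    (h2 : ∀ x : ℝ, |x - a| < r → |(deriv (deriv h) x).re| ≤ L₂ * |(h x).re|)
    (hc : (r ^ 2 + b ^ 2) * (L₂ + 2 * L₁ ^ 2) ≤ 2) :
    ∀ x : ℝ, |x - a| < r →
      ((x - a) ^ 2 + b ^ 2) * (|(deriv (deriv h) x).re| * |(h x).re| + 2 * (deriv h x).re ^ 2) ≤ 2 * (h x).re ^ 2 := by
  intro x hx
  have h1x := h1 x hx
  have h2x := h2 x hx
  set H := |(h x).re| with hH
  have hH0 : 0 ≤ H := abs_nonneg _
  have hQ : (x - a) ^ 2 + b ^ 2 ≤ r ^ 2 + b ^ 2 := by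
    have : (x - a) ^ 2 ≤ r ^ 2 := by
      have hr : 0 ≤ r := (abs_nonneg _).trans hx.le
      rw [← sq_abs (x - a)]
      exact pow_le_pow_left₀ (abs_nonneg _) hx.le 2
    linarith
  have hQ0 : 0 ≤ (x - a) ^ 2 + b ^ 2 := by positivity
  have hsq : (deriv h x).re ^ 2 ≤ L₁ ^ 2 * H ^ 2 := by
    rw [← sq_abs ((deriv h ↑x).re), ← mul_pow]
    exact pow_le_pow_left₀ (abs_nonneg _) h1x 2
  have hA : |(deriv (deriv h) x).re| * |(h x).re| + 2 * (deriv h x).re ^ 2 ≤ (L₂ + 2 * L₁ ^ 2) * H ^ 2 := by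
    have : |(deriv (deriv h) x).re| * H ≤ L₂ * H * H := mul_le_mul_of_nonneg_right h2x hH0
    nlinarith [this, hsq]
  have hre : (h x).re ^ 2 = H ^ 2 := by rw [hH, sq_abs]
  rw [hre]
  calc ((x - a) ^ 2 + b ^ 2) * (|(deriv (deriv h) x).re| * |(h x).re| + 2 * (deriv h x).re ^ 2)
      ≤ (r ^ 2 + b ^ 2) * ((L₂ + 2 * L₁ ^ 2) * H ^ 2) :=
        mul_le_mul hQ hA (by positivity) (by positivity)
    _ = ((r ^ 2 + b ^ 2) * (L₂ + 2 * L₁ ^ 2)) * H ^ 2 := by ring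
    _ ≤ 2 * H ^ 2 := mul_le_mul_of_nonneg_right hc (by positivity)


end RhW08.IsolatedTilt
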